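import Summits.HodgeConjecture.HodgeConjecture.Theorems.MarkmanPartnerTransportPicardThreeK3SquaresZeta11Subtype
import HarnessLib

/-!
# Route MarkmanPartnerTransport · crux `PicardThreeK3Squares` (stmt-HodgeConjecture-19652) —
# HC⁴(S ⊗ S) BY NAME for the sub-types of the ζ₁₁ real-multiplication type (Picard number 7 included)

Cell hodge-nonav, crux #4 (HC⁴(S ⊗ S), ρ(S) ≥ 3; open core: real multiplication), programme «RATIONAL ORBIT
DENSITY» continued (prover seat hodge-nonav-19652-p1 gen 20; `--supports stmt-HodgeConjecture-19652`,
helper). Sequel to `…Zeta11Subtype` (`hodgeConjectureFor_square_of_zeta11Model_of_openAll`: (T⁗) for a ζ₁₁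
datum GIVEN the strong open input). Here the input is supplied BY NAME by the ∀-member form of the van
Geemen–Schütt ∕ Oguiso–Zhang ζ₁₁ fact, `VanGeemenSchuett2025_OguisoZhang2011_zeta11_cycleOnOpenPeriodSet_everyMember`
(`Literature/…/K3RealMultiplicationZeta11OpenFamily`: the cycle on EVERY member of the maximal Dickson family
over an open period set, with a `θ`-generic witness). CONDITIONAL on the two named facts
`Buskin2019_hodgeIsometry_algebraic` and
`VanGeemenSchuett2025_OguisoZhang2011_zeta11_cycleOnOpenPeriodSet_everyMember` ONLY; credits nothing; nothing
here says HC is proved; rung F-H1 not moved.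

* `zeta11_cycleOnOpenPeriodSet_of_everyMember` — the ∀-member fact implies the `θ`-generic fact
  `VanGeemenSchuett2025_OguisoZhang2011_zeta11_cycleOnOpenPeriodSet` (consistency of the two records).
* **`hodgeConjectureFor_square_of_zeta11Subtype`** — for every ζ₁₁ datum `(g, u₁, u₂, y₀, θ)`, EVERY marked
  projective K3 surface with an endomorphism `t` (rational, type-preserving, killing `N¹`, `P₁₁(t) = 0` on
  `T(S)`, generating `End_Hdg T(S)`) conjugate to `θ_ℂ` ON `T(S)` by a rational isometry of `Λ_ℚ` has
  `HodgeConjectureFor 4 (S ⊗ S)` — HC⁴ of the square of every K3 surface with real multiplication by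
  `F = ℚ(ζ₁₁ + ζ₁₁⁻¹)` whose `F`-quadratic space `(T(S)_ℚ, Φ_S)` is represented by the ζ₁₁ model's
  `U^⊥ ⊗ ℚ` (Witt over `ℚ`; not formalised): Picard number `2` (the type: gen 11's
  `hodgeConjectureFor_square_of_zeta11Type`) or `7` (NEW; a condition on the ternary `F`-form — the first
  kernel content at the terminal type `(7,5,3)` of the cell's Noether–Lefschetz ascent, inside crux #4's
  Picard list).

No definition, no sorry. References: van Geemen–Schütt, Forum Math. Sigma 13 (2025) e2, Thm. 1.1 (11), §3.4,
§4.8, §5.8, §6.6; Oguiso–Zhang, Pure Appl. Math. Q. 7 (2011), Thm. 1.5; Buskin, J. reine angew. Math. 755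
(2019), Thm. 1.1; van Geemen, Michigan Math. J. 56 (2008) Lemma 3.2; O'Meara, *Introduction to Quadratic
Forms*, 63:21, 66:3.
-/

set_option linter.dupNamespace false

noncomputable section

namespace Summit.HodgeConjecture.HodgeConjecture.Theorems.MarkmanPartnerTransport.RMTypeOrbit

open CategoryTheory MonoidalCategory Polynomial
open Literature.AlgebraicGeometry Literature.AlgebraicGeometry.Motives Literature.AlgebraicGeometry.HodgeTheory
open Literature.AlgebraicGeometry.Surfaces Literature.LinearAlgebra.QuadraticForm
open Literature.AlgebraicTopology.SingularHomology
open Summit.HodgeConjecture.HodgeConjecture.Theorems.NikulinTwinTransport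
open Summit.HodgeConjecture.HodgeConjecture.Theorems.MarkmanPartnerTransport.IsogenyInvariance
open Summit.HodgeConjecture.HodgeConjecture.Theorems.MarkmanPartnerTransport.RMTypeDescent

/-- `MarkedK3[S, η, p, x]`: VERBATIM the `let MarkedK3 := …` binder of the route declaration
`PicardThreeK3Squares` (as in `…RMTypeDescent`). Local notation only. -/
local notation3 (prettyPrint := false) "MarkedK3[" S ", " η ", " p ", " x "]" =>
  (p ≠ 0 ∧ (IsIntegralClass p ∧
    (∀ q : complexBetti S (2 * 2), IsIntegralClass q → ∃ n : ℤ, q = n • p) ∧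
    (∀ c : complexBetti S (2 * 1), IsIntegralClass c ↔ ∃ v : K3Index → ℤ, η c = fun i => (v i : ℂ)) ∧
    (∀ a b : complexBetti S (2 * 1),
      cupProduct (rfl : 2 * 1 + 2 * 1 = 2 * 2) a b = k3Form (η a) (η b) • p) ∧
    IsOfHodgeType 2 S (2 * 1) 2 0 (LinearEquiv.symm η x) ∧
    (∀ τ : complexBetti S (2 * 1), IsOfHodgeType 2 S (2 * 1) 2 0 τ →
      ∃ t : ℂ, τ = t • LinearEquiv.symm η x)) ∧
    (k3Form x x = 0 ∧ 0 < (k3Form (star x) x).re ∧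
      ∃ u : K3Index → ℤ, k3Form (fun i => (u i : ℂ)) x = 0 ∧ 0 < ∑ i, ∑ j, u i * k3Gram i j * u j))

/-- `Zeta11Model[g, u₁, u₂, y₀, θ]`: VERBATIM the antecedents of the named fact
`VanGeemenSchuett2025_OguisoZhang2011_zeta11_cycleOnOpenPeriodSet` (as in `…PicardThreeK3SquaresZeta11Type`).
Local notation only. -/
local notation3 (prettyPrint := false) "Zeta11Model[" g ", " u₁ ", " u₂ ", " y₀ ", " θ "]" =>
  ((∀ a b : K3Index → ℂ, k3Form (g a) (g b) = k3Form a b) ∧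
    (∀ v : K3Index → ℤ, ∃ w : K3Index → ℤ,
      g (fun i => ((v i : ℤ) : ℂ)) = fun i => ((w i : ℤ) : ℂ)) ∧
    g ^ 11 = 1 ∧
    g (fun i => ((u₁ i : ℤ) : ℂ)) = (fun i => ((u₁ i : ℤ) : ℂ)) ∧
    g (fun i => ((u₂ i : ℤ) : ℂ)) = (fun i => ((u₂ i : ℤ) : ℂ)) ∧
    k3Form (fun i => ((u₁ i : ℤ) : ℂ)) (fun i => ((u₁ i : ℤ) : ℂ)) = 0 ∧
    k3Form (fun i => ((u₂ i : ℤ) : ℂ)) (fun i => ((u₂ i : ℤ) : ℂ)) = 0 ∧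
    k3Form (fun i => ((u₁ i : ℤ) : ℂ)) (fun i => ((u₂ i : ℤ) : ℂ)) = 1 ∧
    (∀ v : K3Index → ℤ, g (fun i => ((v i : ℤ) : ℂ)) = (fun i => ((v i : ℤ) : ℂ)) →
      ∃ m n : ℤ, v = m • u₁ + n • u₂) ∧
    k3Form y₀ y₀ = 0 ∧ 0 < (k3Form (star y₀) y₀).re ∧
    g y₀ = Complex.exp (2 * Real.pi * Complex.I / 11) • y₀ ∧
    (∀ y : K3Index → ℂ, thetaC θ y =
      g y + (g ^ 10) y - (2 * k3Form y (fun i => ((u₂ i : ℤ) : ℂ))) • (fun i => ((u₁ i : ℤ) : ℂ))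
        - (2 * k3Form y (fun i => ((u₁ i : ℤ) : ℂ))) • (fun i => ((u₂ i : ℤ) : ℂ))))

/-- `πU[u₁, u₂]`: the `k3Form`-orthogonal projector `y ↦ (y.u₂)u₁ + (y.u₁)u₂` onto the hyperbolic plane
`ℂu₁ ⊕ ℂu₂` (for `(u₁.u₁) = (u₂.u₂) = 0`, `(u₁.u₂) = 1`). Local notation only. -/
local notation3 (prettyPrint := false) "πU[" u₁ ", " u₂ "]" =>
  ((LinearMap.smulRight (k3FormC (fun i : K3Index => ((u₂ i : ℤ) : ℂ))) (fun i : K3Index => ((u₁ i : ℤ) : ℂ)) +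
      LinearMap.smulRight (k3FormC (fun i : K3Index => ((u₁ i : ℤ) : ℂ))) (fun i : K3Index => ((u₂ i : ℤ) : ℂ)) :
    Module.End ℂ (K3Index → ℂ)))

/-- `Q₁₁ = (X - 2)(X⁵ + X⁴ - 4X³ - 3X² + 3X + 1) ∈ ℚ[X]`: `X - 2` times the minimal polynomial of `ζ₁₁ + ζ₁₁⁻¹`.
Local notation only. -/
local notation3 (prettyPrint := false) "Q₁₁" =>
  ((X - C (2 : ℚ)) * (X ^ 5 + X ^ 4 - C (4 : ℚ) * X ^ 3 - C (3 : ℚ) * X ^ 2 + C (3 : ℚ) * X + 1) : ℚ[X])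

/-- The quintic `P₁₁ = X⁵ + X⁴ - 4X³ - 3X² + 3X + 1 ∈ ℚ[X]` (minimal polynomial of `2cos(2π/11)`).
Local notation only. -/
local notation3 (prettyPrint := false) "P₁₁" =>
  (X ^ 5 + X ^ 4 - C (4 : ℚ) * X ^ 3 - C (3 : ℚ) * X ^ 2 + C (3 : ℚ) * X + 1 : ℚ[X])

/-- `SubSquareHC₁₁[θ]`: **HC⁴(S ⊗ S) for every marked projective K3 surface whose endomorphism `t`
(rational, type-preserving, killing `N¹`, annihilated on `T(S)` by `P₁₁`, generating `End_Hdg T(S)`) is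
conjugate to `θ_ℂ` ON THE TRANSCENDENTAL CLASSES by a rational isometry `σ` of `Λ_ℚ`** — the sub-types of
`θ` (Noether–Lefschetz-special surfaces included). Local notation only. -/
local notation3 (prettyPrint := false) "SubSquareHC₁₁[" θ "]" =>
  (∀ (S : SchemeOver ℂ) (hS : IsK3Surface S)
    (η : complexBetti S (2 * 1) ≃ₗ[ℂ] (K3Index → ℂ)) (p : complexBetti S (2 * 2)) (x : K3Index → ℂ)
    (_hM : MarkedK3[S, η, p, x])
    (t : complexBetti S (2 * 1) →ₗ[ℂ] complexBetti S (2 * 1))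
    (_ht_rat : ∀ y, IsRationalClass y → IsRationalClass (t y))
    (_ht_typ : ∀ (i j : ℕ) (y : complexBetti S (2 * 1)),
      IsOfHodgeType 2 S (2 * 1) i j y → IsOfHodgeType 2 S (2 * 1) i j (t y))
    (_ht_N : ∀ d ∈ algebraicClasses S 1, t d = 0)
    (_hP : IsAnnihilatedOnTranscendentalBy S t P₁₁) (_hgen : TranscendentalEndomorphismsGeneratedBy S t)
    (σ : Module.End ℂ (K3Index → ℂ)) (_hσ : ∀ a b, k3Form (σ a) (σ b) = k3Form a b)
    (_hσrat : ∀ v : K3Index → ℤ, ∃ w : K3Index → ℚ, σ (fun i => (v i : ℂ)) = fun i => (w i : ℂ))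
    (_hconj : ∀ c : complexBetti S (2 * 1),
      (∀ d ∈ algebraicClasses S 1, cupProduct (rfl : 2 * 1 + 2 * 1 = 2 * 2) c d = 0) →
        σ (η (t c)) = thetaC θ (σ (η c))),
    HodgeConjectureFor 4 (S ⊗ S))

variable {g : Module.End ℂ (K3Index → ℂ)} {u₁ u₂ : K3Index → ℤ} {y₀ : K3Index → ℂ}
  {θ : Matrix K3Index K3Index ℚ}

/-- **The ∀-member ζ₁₁ fact implies the `θ`-generic one**
(`VanGeemenSchuett2025_OguisoZhang2011_zeta11_cycleOnOpenPeriodSet`): drop the genericity clause of the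
witness and restrict the cycle clause. [cite: GeemenSchutt2023, Thm. 1.1 (11) and §4.8]
[cite: OguisoZhang2011K3Order11, Thm. 1.5 (3)] -/
theorem zeta11_cycleOnOpenPeriodSet_of_everyMember
    (h : VanGeemenSchuett2025_OguisoZhang2011_zeta11_cycleOnOpenPeriodSet_everyMember) :
    VanGeemenSchuett2025_OguisoZhang2011_zeta11_cycleOnOpenPeriodSet := by
  intro g u₁ u₂ y₀ θ hg hgint hg11 hgu₁ hgu₂ hu₁ hu₂ hu₁₂ hfix hy₀₀ hy₀p hgy₀ hθ
  obtain ⟨U, hU, ⟨y₁, hy₁U, hy₁, h₁₁, h₁p, -⟩, hcyc⟩ :=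
    h g u₁ u₂ y₀ θ hg hgint hg11 hgu₁ hgu₂ hu₁ hu₂ hu₁₂ hfix hy₀₀ hy₀p hgy₀ hθ
  exact ⟨U, hU, ⟨y₁, hy₁U, hy₁, h₁₁, h₁p⟩, fun y hyU hy hyy hyp _ => hcyc y hyU hy hyy hyp⟩

/-- **HC⁴(S ⊗ S) for every K3 surface of a SUB-TYPE of the ζ₁₁ real-multiplication type** — the
Noether–Lefschetz-special surfaces of the ζ₁₁ locus included. For every ζ₁₁ datum `(g, u₁, u₂, y₀, θ)`
(an integral isometry `g` of `Λ` of order `11` with invariant plane `ℤu₁ ⊕ ℤu₂ ≅ U`, a period point `y₀`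
in its `ζ₁₁`-eigenspace, and the model endomorphism `θ`, `θ_ℂ = (g + g¹⁰) - 2π_U`), EVERY projective K3
surface `S`, marked by `(η, p, x)` and carrying an endomorphism `t` of `H²(S(ℂ); ℂ)` — rational,
Hodge-type preserving, killing `N¹H²`, with `P₁₁(t) = t⁵ + t⁴ - 4t³ - 3t² + 3t + 1 = 0` on `T(S)` (real
multiplication by the quintic field `F = ℚ[t] ≅ ℚ(ζ₁₁ + ζ₁₁⁻¹)`), generating `End_Hdg T(S)` — which is
conjugate to `θ_ℂ` ON `T(S)` by a rational isometry `σ` of `Λ_ℚ` (`σ η (t c) = θ_ℂ σ η c` for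
`c ⊥ N¹(S)`; NOT necessarily on `N¹(S)`), satisfies `HodgeConjectureFor 4 (S ⊗ S)`. Which surfaces these
are (NOT formalised): by Witt's theorem over `ℚ`, exactly the `S` whose pair `(T(S)_ℚ, t)` embeds
isometrically and `t ↦ θ`-equivariantly into the model `(Λ_ℚ, θ)`, i.e. whose `F`-quadratic space
`(T(S)_ℚ, Φ_S)` is REPRESENTED by the model's `F`-quadratic space `U^⊥ ⊗ ℚ ≅ (U² ⊕ E₈²) ⊗ ℚ` of `F`-rank
`4`; so `rank_F T(S) ∈ {3, 4}`, i.e. `ρ(S) ∈ {7, 2}` (van Geemen: `rank_F T ≥ 3`). At `ρ(S) = 7` — the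
terminal type `(7,5,3)` of the cell's Noether–Lefschetz ascent, INSIDE the crux's Picard list — the
representation of the ternary `Φ_S` by the quaternary model form is a CONDITION (Hasse–Minkowski over `F`:
local symbols at finitely many primes; the real places are matched by choosing `t` among the five roots),
met by some and not by all such `S`. The `θ`-generic surfaces (`ρ(S) = 2`, cell (3,5)) are the case of
`hodgeConjectureFor_square_of_zeta11Type`; the new surfaces are the `ρ(S) = 7` ones. Proof: the fact
supplies `OpenAll[θ, e₀]` for the datum; `hodgeConjectureFor_square_of_zeta11Model_of_openAll`. CONDITIONAL on
`Buskin2019_hodgeIsometry_algebraic` and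
`VanGeemenSchuett2025_OguisoZhang2011_zeta11_cycleOnOpenPeriodSet_everyMember` ONLY; credits nothing; HC is
NOT proved here; rung F-H1 not moved. [cite: GeemenSchutt2023, Thm. 1.1 (11), §3.4, §4.8, §5.8 and §6.6]
[cite: OguisoZhang2011K3Order11, Thm. 1.5 (3)] [cite: Buskin2019, Thm. 1.1] [cite: Omeara1963, 63:21 and 66:3]
[cite: VanGeemen2008RM, Lemma 3.2] -/
theorem hodgeConjectureFor_square_of_zeta11Subtype
    (hB : Buskin2019_hodgeIsometry_algebraic)
    (hV : VanGeemenSchuett2025_OguisoZhang2011_zeta11_cycleOnOpenPeriodSet_everyMember)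
    (hZ : Zeta11Model[g, u₁, u₂, y₀, θ]) : SubSquareHC₁₁[θ] := by
  obtain ⟨hg, hgint, hg11, hgu₁, hgu₂, hu₁, hu₂, hu₁₂, hfix, hy₀₀, hy₀p, hgy₀, hθ⟩ := hZ
  obtain ⟨U, hU, ⟨y₁, hy₁U, hy₁, h₁₁, h₁p, hy₁gen⟩, hcyc⟩ :=
    hV g u₁ u₂ y₀ θ hg hgint hg11 hgu₁ hgu₂ hu₁ hu₂ hu₁₂ hfix hy₀₀ hy₀p hgy₀ hθ
  exact hodgeConjectureFor_square_of_zeta11Model_of_openAll hB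
    ⟨hg, hgint, hg11, hgu₁, hgu₂, hu₁, hu₂, hu₁₂, hfix, hy₀₀, hy₀p, hgy₀, hθ⟩
    ⟨U, hU, ⟨y₁, hy₁U, hy₁, h₁₁, h₁p, hy₁gen⟩, fun y hyU hy hyy hyp =>
      let ⟨S', hS', η', p', hM', hγ'⟩ := hcyc y hyU hy hyy hyp
      ⟨S', hS', η', p', hM', hγ'⟩⟩

end Summit.HodgeConjecture.HodgeConjecture.Theorems.MarkmanPartnerTransport.RMTypeOrbit

end
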